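import Mathlib
import Literature.NumberTheory.LFunctions.Zhang2022.Section17InnerChiIdentities
import Literature.NumberTheory.LFunctions.Zhang2022.KappaLSeries
import Literature.NumberTheory.LFunctions.Zhang2022.SmoothWeightSegmentTail
import Literature.NumberTheory.LFunctions.Zhang2022.SmoothWeightDiagonal
import HarnessLib

/-!
# Zhang (2022) §17 p. 97–98: `Φ₃⁻(p)` per character — the integrand `𝔨₃*(s,ψ)ω(s)` on `𝔍(−1)`,
# reflected to `σ = 3/2`, and the term-by-term step with the segment→line error explicit

Topic `Literature/NumberTheory/LFunctions/Zhang2022` (Landau–Siegel audit tree; verdict-neutral).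
Y. Zhang, *Discrete mean estimates and the Landau–Siegel zero*, arXiv:2211.02515v1 (2022)
[Zhang2022LandauSiegel] — **an unrefereed manuscript under adjudication; nothing in this file asserts
or denies its Theorems 1–2.** §17 p. 97–98 [tex L4780–L4813]: "`Φ₃⁻(p) = Σ*_{ψ (mod p)}
(1/2πi)∫_{𝔍(−1)} 𝔨₃*(s,ψ)ω(s)ds` where `𝔨₃*(s,ψ) = (L(1−s−β₁,ψ̄)/L(1−s,ψ̄))F(1−s,ψ̄)B(s,ψ)G(s,ψ)
N(s+β₂,ψ)N(s+β₃,ψ)` … In a way similar to the proof of (17.3) we deduce that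
`Φ₃⁻(p) = pΣ_n (b∗ν₁*)(n)ϱ*(n)/n + o(p)`" ((17.8); in the χ-twisted reading of record RT16-int-1 the
coefficient is `(bχ)∗ν₁*`, typed `Typed.Section17.Eq17_8Chi`). This file is the first of the (17.8)χ
discharge (WP16 helper of the `Eq17_9Rel` chain) and is the exact twin of `Section17Phi3plusLine`
((17.3), `𝔍(1)`): the segment `𝔍(−1)` is REFLECTED by `s ↦ 1 − s` onto the segment `𝔍(1)` of the
mirror point `s₀′ = 1 − s₀ = s₀(−t₀)`, under which `ω` keeps its shape (`ω_{t₀}(1−s) = ω_{−t₀}(s)`)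
and `𝔨₃*(1−s,ψ) = [Σ_m ϱ*_≤(m)ψ̄(m)m^{−s}]·[Σ_n ((bχ)∗ν₁*)(n)ψ(n)n^{s−1}]` (`Re s = 3/2`; tree
§17.u016/u017 `step17_u017_le_holds`, u015χ `step17_u015_chi`) has precisely the shape of the tree's
Gaussian-Mellin machinery (`SmoothWeightMellin`, `SmoothWeightSegmentTail`, any real `t₀`). PROVED
(UNCONDITIONAL, every modulus `D ≥ 2`, 0 new facts):

* `segInt_neg_one_eq_reflect`, `omega_one_sub` — the reflection identities;
* `LSeriesSummable_varrhoLe_conj` — `Σ_m ϱ*_≤(m)ψ̄(m)m^{−s}` converges absolutely for `σ > 1`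
  (`ϱ*_≤ = (ν·[≤D⁴]) ∗ κ̄₂`, `κ̄₂ = κ₂^{(−b₁)}`: `KappaLSeries.LSeriesSummable_kappa₂`);
* `kfrak3Star_one_sub_mul_omega_eq` — the reflected integrand on `σ > 1`;
* **`norm_segInt_kfrak3Star_sub_tsum_le`** — for ONE character `ψ` and any index `M` from which
  `(bχ)∗ν₁*` vanishes: `‖(1/2πi)∫_{𝔍(−1)}𝔨₃*ω ds − Σ_mΣ_{1≤n<M} ϱ*_≤(m)ψ̄(m)m^{−s₀′}·((bχ)∗ν₁*)(n)ψ(n)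
  n^{s₀′−1}·e^{−𝓛₂²log²(n/m)}‖ ≤ (Σ_m|ϱ*_≤ψ̄|m^{−3/2})(Σ_{n<M}|((bχ)∗ν₁*)ψ|√n)e^{(1−𝓛₁²)/(4𝓛₂²)}`.

The companion files sum this over `Σ*_{ψ (mod p)}` (diagonal `#Σ* = p − 2`, off-diagonal) and
assemble `Eq17_8Chi`. Nothing here bears on Theorems 1–2 of the source or on Landau–Siegel zeros.

## References

* Y. Zhang, arXiv:2211.02515v1 (2022), §17 pp. 97–98 (u012, u013, (17.8)); §2 (2.15).
  [cite: Zhang2022LandauSiegel, §17 (17.8) p. 98]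
-/
noncomputable section

open Complex Real ComplexConjugate

namespace Literature.NumberTheory.LFunctions.Zhang2022.Phi3Minus

open Literature.NumberTheory.LFunctions.Zhang2022
open Literature.NumberTheory.LFunctions.Zhang2022.Skeleton
open Literature.NumberTheory.LFunctions.Zhang2022.Typed.Section17
open scoped LSeries.notation

variable (c' : ℝ) {D : ℕ} [NeZero D] (χ : DirichletCharacter ℂ D)

/-! ## The reflection `s ↦ 1 − s`: `𝔍(−1) → 𝔍′(1)`, `ω_{t₀} → ω_{−t₀}` -/

/-- `1 − s₀(t₀) = s₀(−t₀)` (`s₀ = 1/2 + 2πit₀`). [cite: Zhang2022LandauSiegel, §2 (2.8)] -/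
theorem one_sub_s0 (t₀ : ℝ) : 1 - SmoothWeight.s0 t₀ = SmoothWeight.s0 (-t₀) := by
  rw [SmoothWeight.s0_def, SmoothWeight.s0_def]; push_cast; ring

/-- **`ω_{t₀}(1 − s) = ω_{−t₀}(s)`**: the weight (2.15) is even about `s₀`, and `1 − s − s₀(t₀) =
−(s − s₀(−t₀))`. [cite: Zhang2022LandauSiegel, §2 (2.15)] -/
theorem omega_one_sub (L₂ t₀ : ℝ) (s : ℂ) :
    SmoothWeight.omega L₂ t₀ (1 - s) = SmoothWeight.omega L₂ (-t₀) s := by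
  rw [SmoothWeight.omega_def, SmoothWeight.omega_def]
  have e : (1 - s - SmoothWeight.s0 t₀) ^ 2 = (s - SmoothWeight.s0 (-t₀)) ^ 2 := by
    rw [← one_sub_s0]; ring
  rw [e]

/-- **`(1/2πi)∫_{𝔍(−1)} F(s) ds = (1/2πi)∫_{𝔍′(1)} F(1 − s′) ds′`**, `𝔍′(1)` the segment of abscissa
`1` about the mirror point `s₀(−t₀) = 1 − s₀(t₀)`: in the parametrisation `s = −1 + s₀ + iv` one has
`1 − (1 + s₀(−t₀) + iu) = −1 + s₀(t₀) − iu`, and `∫_{−𝓛₁}^{𝓛₁}` is symmetric under `u ↦ −u`.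
[cite: Zhang2022LandauSiegel, §17 p. 97 (u013)] -/
theorem segInt_neg_one_eq_reflect (t₀ L₁ : ℝ) (F : ℂ → ℂ) :
    Lemma81.segInt t₀ L₁ (-1) F = Lemma81.segInt (-t₀) L₁ 1 (fun s => F (1 - s)) := by
  rw [Lemma81.segInt_def, Lemma81.segInt_def]
  congr 1
  have e : ∀ v : ℝ, 1 - ((1 : ℂ) + SmoothWeight.s0 (-t₀) + v * I) =
      (-1 : ℂ) + SmoothWeight.s0 t₀ + (((-v : ℝ) : ℂ)) * I := by
    intro v
    rw [← one_sub_s0]; push_cast; ring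
  simp_rw [e]
  rw [intervalIntegral.integral_comp_neg (fun v : ℝ => F ((-1 : ℂ) + SmoothWeight.s0 t₀ + (v : ℂ) * I))]
  simp

/-! ## The coefficient series `ϱ*_≤·ψ̄` on `σ > 1` -/

omit [NeZero D] in
/-- `(f ∗ g)·t = (f·t) ∗ (g·t)` for a completely multiplicative twist `t`. [folklore] -/
private theorem convolution_mul_twist (t : ℕ → ℂ) (ht : ∀ a b : ℕ, t (a * b) = t a * t b)
    (f g : ℕ → ℂ) :
    (fun n => (f ⍟ g) n * t n) = (fun n => f n * t n) ⍟ (fun n => g n * t n) := by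
  funext n
  rw [LSeries.convolution_def, LSeries.convolution_def]
  simp only []
  rw [Finset.sum_mul]
  refine Finset.sum_congr rfl fun q hq => ?_
  have hqn : q.1 * q.2 = n := (Nat.mem_divisorsAntidiagonal.mp hq).1
  rw [← hqn, ht]
  ring

omit [NeZero D] in
/-- `ψ̄ = conj ψ` is completely multiplicative on `ℕ`. [folklore] -/
private theorem conj_psi_mul (x : Chr D) (a b : ℕ) :
    conj (x.ψ ((a * b : ℕ) : ZMod x.p)) = conj (x.ψ (a : ZMod x.p)) * conj (x.ψ (b : ZMod x.p)) := by
  rw [Nat.cast_mul, map_mul, map_mul]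

omit [NeZero D] in
/-- `conj ψ(a) = ψ⁻¹(a)`. [folklore] -/
private theorem conj_psi_apply (x : Chr D) (a : ZMod x.p) : conj (x.ψ a) = x.ψ⁻¹ a := by
  rw [← MulChar.star_apply']
  rfl

omit [NeZero D] in
/-- A sequence vanishing from `N` on has an everywhere-summable `L`-series. [folklore] -/
private theorem LSeriesSummable_of_eventually_zero {h : ℕ → ℂ} (N : ℕ) (hN : ∀ n, N ≤ n → h n = 0)
    (s : ℂ) : LSeriesSummable h s := by
  refine summable_of_ne_finset_zero (s := Finset.range N) fun n hn => ?_
  have hn' : N ≤ n := by simpa using hn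
  rcases eq_or_ne n 0 with rfl | h0
  · simp [LSeries.term]
  · rw [LSeries.term_of_ne_zero h0, hN n hn', zero_div]

omit [NeZero D] in
/-- **`Σ_m ϱ*_≤(m)ψ̄(m)m^{−s}` converges absolutely for `σ > 1`** (`ϱ*_≤ = (ν·[≤D⁴]) ∗ κ̄₂`; the twist
commutes with the convolution; `κ̄₂ψ̄ = κ₂^{(−b₁)}ψ⁻¹` has an absolutely convergent `L`-series there by
`LFunction_ratio_eq_LSeries_kappa₂`, the other factor is finitely supported).
[cite: Zhang2022LandauSiegel, §17 u017 p.97] -/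
theorem LSeriesSummable_varrhoLe_conj (x : Chr D) {s : ℂ} (hs : 1 < s.re) :
    LSeriesSummable (fun m => (trunc (D ^ 4) (nu χ) ⍟ kappa2bar c' D) m *
      conj (x.ψ (m : ZMod x.p))) s := by
  have h1 : LSeriesSummable (fun n => trunc (D ^ 4) (nu χ) n * conj (x.ψ (n : ZMod x.p))) s := by
    refine LSeriesSummable_of_eventually_zero (D ^ 4 + 1) (fun n hn => ?_) s
    have : ¬ n ≤ D ^ 4 := by omega
    simp [trunc, this]
  have h2 : LSeriesSummable (fun n => kappa2bar c' D n * conj (x.ψ (n : ZMod x.p))) s := by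
    obtain ⟨-, hsum⟩ := LFunction_ratio_eq_LSeries_kappa₂ x.ψ⁻¹ (-(b1 c' D)) s hs
    have hfg : (fun n => kappa2bar c' D n * conj (x.ψ (n : ZMod x.p))) =
        fun n => MeanSquareMajorant.kappa₂ (-(b1 c' D)) n * x.ψ⁻¹ (n : ZMod x.p) := by
      funext n; rw [kappa2bar_eq_kappa₂_neg, conj_psi_apply]
    rw [hfg]; exact hsum
  rw [convolution_mul_twist _ (conj_psi_mul x)]
  exact h1.convolution h2

/-! ## The reflected integrand on `σ > 1` -/

omit [NeZero D] in
/-- `Σ' m ϱ*_≤(m)ψ̄(m)m^{−s}` is the `LSeries` of `ϱ*_≤·ψ̄`. [folklore] -/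
private theorem tsum_varrhoLe_eq_LSeries (x : Chr D) (s : ℂ) :
    ∑' n : ℕ, (trunc (D ^ 4) (nu χ) ⍟ kappa2bar c' D) n * conj (x.ψ (n : ZMod x.p)) *
        (n : ℂ) ^ (-s)
      = LSeries (fun m => (trunc (D ^ 4) (nu χ) ⍟ kappa2bar c' D) m * conj (x.ψ (m : ZMod x.p))) s := by
  refine tsum_congr fun m => ?_
  rcases eq_or_ne m 0 with rfl | hm
  · simp [LSeries.term]
  · rw [LSeries.term_of_ne_zero hm, div_eq_mul_inv, Complex.cpow_neg]

/-- **The reflected integrand of `Φ₃⁻(p)` on `σ > 1`**: for every index `M` from which `(bχ)∗ν₁*`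
vanishes and every `s` with `Re s > 1`,
`𝔨₃*(1−s,ψ)ω_{t₀}(1−s) = (Σ_m ϱ*_≤(m)ψ̄(m)m^{−s})·(Σ_{1≤n<M} ((bχ)∗ν₁*)(n)ψ(n)n^{s−1})·ω_{−t₀}(s)`
(u016/u017 in the `≤ D⁴` reading `step17_u017_le_holds`, u015χ `step17_u015_chi`, `omega_one_sub`).
[cite: Zhang2022LandauSiegel, §17 pp.97–98] -/
theorem kfrak3Star_one_sub_mul_omega_eq (x : Chr D) {M : ℕ}
    (hM : ∀ n, M ≤ n → ((fun n => bcoef D n * χ (n : ZMod D)) ⍟ nuOneStar c' χ) n = 0)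
    {s : ℂ} (hs : 1 < s.re) :
    kfrak3Star c' χ x (1 - s) * omegaW D (1 - s)
      = LSeries (fun m => (trunc (D ^ 4) (nu χ) ⍟ kappa2bar c' D) m * conj (x.ψ (m : ZMod x.p))) s *
          (∑ n ∈ Finset.Ico 1 M,
            (((fun n => bcoef D n * χ (n : ZMod D)) ⍟ nuOneStar c' χ) n * x.ψ (n : ZMod x.p)) *
              (n : ℂ) ^ (s - 1)) *
          SmoothWeight.omega (ell2 D) (-t0 D) s := by
  have hs' : (1 - s).re < 0 := by simp; linarith
  have h17 := step17_u017_le_holds c' (χ := χ) x (1 - s) hs'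
  have h15 := step17_u015_chi c' χ x (1 - s)
  rw [sub_sub_cancel] at h17
  -- the finite Dirichlet polynomial as a sum over `[1, M)`
  have hfin : (∑' n : ℕ, ((fun n => bcoef D n * χ (n : ZMod D)) ⍟ nuOneStar c' χ) n *
        x.ψ (n : ZMod x.p) * (n : ℂ) ^ (-(1 - s)))
      = ∑ n ∈ Finset.Ico 1 M,
          (((fun n => bcoef D n * χ (n : ZMod D)) ⍟ nuOneStar c' χ) n * x.ψ (n : ZMod x.p)) *
            (n : ℂ) ^ (s - 1) := by
    rw [tsum_eq_sum (s := Finset.Ico 1 M)]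
    · refine Finset.sum_congr rfl fun n _ => ?_
      rw [neg_sub]
    · intro n hn
      rcases eq_or_ne n 0 with rfl | h0
      · simp
      · have hMn : M ≤ n := by
          by_contra h
          exact hn (Finset.mem_Ico.mpr ⟨Nat.one_le_iff_ne_zero.mpr h0, not_le.mp h⟩)
        rw [hM n hMn, zero_mul, zero_mul]
  unfold kfrak3Star
  rw [omegaW, omega_one_sub]
  simp only [sub_sub_cancel]
  calc DirichletCharacter.LFunction x.ψ⁻¹ (s - beta1 c' D) /
          DirichletCharacter.LFunction x.ψ⁻¹ s * FpolyBar χ x s *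
        Bpoly χ x (1 - s) * Gpoly χ x (1 - s) * Nchar D (psiFn x) (1 - s + beta2 c' D) *
        Nchar D (psiFn x) (1 - s + beta3 c' D) * SmoothWeight.omega (ell2 D) (-t0 D) s
      = (DirichletCharacter.LFunction x.ψ⁻¹ (s - beta1 c' D) /
          DirichletCharacter.LFunction x.ψ⁻¹ s * FpolyBar χ x s) *
        (Bpoly χ x (1 - s) * Gpoly χ x (1 - s) * Nchar D (psiFn x) (1 - s + beta2 c' D) *
          Nchar D (psiFn x) (1 - s + beta3 c' D)) * SmoothWeight.omega (ell2 D) (-t0 D) s := by ring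
    _ = _ := by rw [h17, h15, tsum_varrhoLe_eq_LSeries, hfin]

/-! ## Term by term, one character -/

/-- **Term by term, one character** (§17 p. 98, "in a way similar to the proof of (17.3)"): for `ψ ∈ Ψ`,
`D ≥ 2`, and any index `M` from which `(bχ)∗ν₁*` vanishes, the segment integral
`(1/2πi)∫_{𝔍(−1)}𝔨₃*(s,ψ)ω(s)ds` equals the double sum
`Σ_mΣ_{1≤n<M} ϱ*_≤(m)ψ̄(m)m^{−s₀′}·((bχ)∗ν₁*)(n)ψ(n)n^{s₀′−1}·e^{−𝓛₂²log²(n/m)}` (`s₀′ = s₀(−t₀)`) up to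
an error `≤ (Σ_m|ϱ*_≤(m)ψ̄(m)|m^{−3/2})(Σ_{n<M}|((bχ)∗ν₁*)(n)ψ(n)|√n)e^{(1−𝓛₁²)/(4𝓛₂²)}` — reflection to
`𝔍′(1)`, then the tree's `SmoothWeight.norm_lineIntegral_sub_segInt_le` and
`SmoothWeight.integral_LSeries_mul_sum_mul_omega` at `t₀ ↦ −t₀`.
[cite: Zhang2022LandauSiegel, §17 (17.8) p.98] -/
theorem norm_segInt_kfrak3Star_sub_tsum_le (hD : 2 ≤ D) (x : Chr D) {M : ℕ}
    (hM : ∀ n, M ≤ n → ((fun n => bcoef D n * χ (n : ZMod D)) ⍟ nuOneStar c' χ) n = 0) :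
    ‖Lemma81.segInt (t0 D) (ell1 D) (-1) (fun s => kfrak3Star c' χ x s * omegaW D s) -
        ∑' m : ℕ, ∑ n ∈ Finset.Ico 1 M,
          LSeries.term (fun m => (trunc (D ^ 4) (nu χ) ⍟ kappa2bar c' D) m *
              conj (x.ψ (m : ZMod x.p))) (SmoothWeight.s0 (-t0 D)) m *
            ((((fun n => bcoef D n * χ (n : ZMod D)) ⍟ nuOneStar c' χ) n * x.ψ (n : ZMod x.p)) *
              (n : ℂ) ^ (SmoothWeight.s0 (-t0 D) - 1)) *
            cexp (-(ell2 D : ℂ) ^ 2 * (Real.log ((n : ℝ) / m) : ℂ) ^ 2)‖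
      ≤ (∑' m : ℕ, ‖LSeries.term (fun m => (trunc (D ^ 4) (nu χ) ⍟ kappa2bar c' D) m *
              conj (x.ψ (m : ZMod x.p))) (3 / 2 : ℂ) m‖) *
          (∑ n ∈ Finset.Ico 1 M,
            ‖((fun n => bcoef D n * χ (n : ZMod D)) ⍟ nuOneStar c' χ) n * x.ψ (n : ZMod x.p)‖ *
              Real.sqrt n) *
          Real.exp ((1 - ell1 D ^ 2) / (4 * ell2 D ^ 2)) := by
  have hL : 0 < ell2 D := pow_pos (Real.log_pos (by exact_mod_cast hD)) _
  have hL₁ : 0 ≤ ell1 D := pow_nonneg (Real.log_natCast_nonneg D) _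
  have hS : (0 : ℕ) ∉ Finset.Ico 1 M := by simp
  set a : ℕ → ℂ := fun m => (trunc (D ^ 4) (nu χ) ⍟ kappa2bar c' D) m * conj (x.ψ (m : ZMod x.p))
    with ha_def
  set b : ℕ → ℂ := fun n =>
    ((fun n => bcoef D n * χ (n : ZMod D)) ⍟ nuOneStar c' χ) n * x.ψ (n : ZMod x.p) with hb_def
  have ha : LSeriesSummable a (((1 : ℝ) + 1 / 2 : ℝ) : ℂ) :=
    LSeriesSummable_varrhoLe_conj c' χ x (by rw [Complex.ofReal_re]; norm_num)
  -- the reflected integrand along the line through `𝔍′(1)` is the `SmoothWeightMellin` integrand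
  have hG : ∀ v : ℝ, kfrak3Star c' χ x (1 - (((1 : ℝ) : ℂ) + SmoothWeight.s0 (-t0 D) + v * I)) *
        omegaW D (1 - (((1 : ℝ) : ℂ) + SmoothWeight.s0 (-t0 D) + v * I))
      = LSeries a (((1 : ℝ) : ℂ) + SmoothWeight.s0 (-t0 D) + v * I) *
          (∑ n ∈ Finset.Ico 1 M, b n *
            (n : ℂ) ^ ((((1 : ℝ) : ℂ) + SmoothWeight.s0 (-t0 D) + v * I) - 1)) *
          SmoothWeight.omega (ell2 D) (-t0 D) (((1 : ℝ) : ℂ) + SmoothWeight.s0 (-t0 D) + v * I) := by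
    intro v
    refine kfrak3Star_one_sub_mul_omega_eq c' χ x hM ?_
    rw [SmoothWeight.linePoint_re]; norm_num
  -- reflect `𝔍(−1)` to `𝔍′(1)` and identify the integrands on the segment
  have hseg : Lemma81.segInt (t0 D) (ell1 D) (-1) (fun s => kfrak3Star c' χ x s * omegaW D s)
      = Lemma81.segInt (-t0 D) (ell1 D) ((1 : ℝ) : ℂ) (fun s => LSeries a s *
          (∑ n ∈ Finset.Ico 1 M, b n * (n : ℂ) ^ (s - 1)) *
          SmoothWeight.omega (ell2 D) (-t0 D) s) := by
    rw [segInt_neg_one_eq_reflect, Lemma81.segInt_def, Lemma81.segInt_def, Complex.ofReal_one]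
    congr 1
    refine intervalIntegral.integral_congr fun v _ => ?_
    have := hG v
    rw [Complex.ofReal_one] at this
    exact this
  have htail := SmoothWeight.norm_lineIntegral_sub_segInt_le hL (-t0 D) 1 ha b hS hL₁
  have hmain := SmoothWeight.integral_LSeries_mul_sum_mul_omega hL (-t0 D) 1 ha b hS
  rw [hseg, ← hmain, norm_sub_rev]
  refine htail.trans (le_of_eq ?_)
  rw [show ((1 : ℝ) + 1 / 2 - 1 : ℝ) = 1 / 2 by norm_num,
    show (((1 : ℝ) + 1 / 2 : ℝ) : ℂ) = (3 / 2 : ℂ) by push_cast; norm_num, one_pow]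
  congr 2
  refine Finset.sum_congr rfl fun n _ => ?_
  rw [Real.sqrt_eq_rpow]

end Literature.NumberTheory.LFunctions.Zhang2022.Phi3Minus
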